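import Summits.HodgeConjecture.HodgeConjecture.Theorems.MarkmanPartnerTransportPartnerTransportLattice
import Summits.HodgeConjecture.HodgeConjecture.Theorems.MarkmanPartnerTransportPartnerExistenceK3Side
import Literature.AlgebraicGeometry.Hyperkaehler.K3HilbertTypeHodgeIsometryLift

/-!
# Route MarkmanPartnerTransport · support `PartnerTransport` (stmt-HodgeConjecture-19650) —
# Picard numbers along a partner: `ρ(X) ≤ ρ(S^{[2]}) ≤ ρ(S) + 1`

For the data of `exists_markedHodgeIsometry_of_partner` (marked `(X, φ, P, z)`; marked projective K3
`(S, η, p, x)`; the fourfold `H = S^{[2]}` marked with period `(x, 0)` and the algebraic incidence `θ`,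
`φ_H([θ]_* a) = (η a, 0)`; a partner map `g : H²(S) → H²(X)`):

* `finrank_algebraicClasses_le_succ_of_hilbertSquareMarking` — **`ρ(H) ≤ ρ(S) + 1`**: the map
  `w ↦ η⁻¹((φ_H w)|_{Λ_{K3}})` carries `N¹(H)` into `N¹(S)` (rational `(1,1)`-classes go to rational
  `(1,1)`-classes — (m5) for `H`, the period description of `H^{1,1}(S)`, Lefschetz `(1,1)` on `S`) and its
  kernel on `N¹(H)` is at most the line `ℂ·δ`;
* `finrank_algebraicClasses_le_of_partner` — **`ρ(X) ≤ ρ(H)`**: with (g1), (g4), (g5) the rational matrix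
  of `φ ∘ g ∘ η⁻¹ ∘ pr` is an injective `q`-isometry `T_ℚ(H) ↪ T_ℚ(X)`, so `23 − ρ(H) ≤ 23 − ρ(X)`;
* `finrank_algebraicClasses_le_partner_succ` — hence **`ρ(X) ≤ ρ(S) + 1`** for every K3 partner
  realised on a marked Hilbert square (the transfer of K3-square theorems indexed by `ρ(S)` to
  `K3^{[2]}`-type fourfolds indexed by `ρ(X)`).

No definition, no sorry, no named fact. Prover seat hodge-nonav-19652-p1 (gen 6),
`--supports stmt-HodgeConjecture-19650`.

References: A. Beauville, J. Differential Geom. 18 (1983) §6 Prop. 6 and Remarque (`H²(S^{[2]},ℤ) =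
i(H²(S,ℤ)) ⊕ ℤδ`), §9; D. Huybrechts, *Lectures on K3 Surfaces* Ch. 3 §2–3; C. Voisin, *Hodge Theory I*
Thm. 11.30.
-/

noncomputable section

set_option linter.dupNamespace false

open scoped Matrix
open Module CategoryTheory MonoidalCategory
open Literature.AlgebraicTopology.SingularHomology Literature.Geometry.Kaehler
open Literature.AlgebraicGeometry Literature.AlgebraicGeometry.Motives Literature.AlgebraicGeometry.HodgeTheory
open Literature.AlgebraicGeometry.Hyperkaehler Literature.AlgebraicGeometry.Surfaces
open Summit.HodgeConjecture.HodgeConjecture.Theorems.NikulinTwinTransport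
open Summit.HodgeConjecture.HodgeConjecture.Theorems.MarkmanPartnerTransport.BBFPositivity

namespace Summit.HodgeConjecture.HodgeConjecture.Theorems.MarkmanPartnerTransport.PartnerLattice

/-- `MarkedK3Sq[X, φ, P, z]`: VERBATIM the `let MarkedK3Sq := …` binder of the route declarations of
MarkmanPartnerTransport (clauses (m1)–(m6)). Local notation only. -/
local notation3 (prettyPrint := false) "MarkedK3Sq[" X ", " φ ", " P ", " z "]" =>
  (((IsIntegralClass P ∧ ∀ Q : complexBetti X (2 * 4), IsIntegralClass Q → ∃ n : ℤ, Q = n • P) ∧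
    (∀ c : complexBetti X 2, IsIntegralClass c ↔ ∃ v : K3HilbertIndex → ℤ, φ c = fun i => (v i : ℂ)) ∧
    (∀ a : complexBetti X 2, cupPowTwo a 4 = ((3 : ℂ) * (k3HilbertForm 2 (φ a) (φ a)) ^ 2) • P) ∧
    (IsOfHodgeType 4 X 2 2 0 (LinearEquiv.symm φ z) ∧
      ∀ τ : complexBetti X 2, IsOfHodgeType 4 X 2 2 0 τ → ∃ t : ℂ, τ = t • LinearEquiv.symm φ z) ∧
    (∀ c : complexBetti X 2, IsOfHodgeType 4 X 2 1 1 c ↔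
      (k3HilbertForm 2 (φ c) z = 0 ∧ k3HilbertForm 2 (φ c) (star z) = 0)) ∧
    (k3HilbertForm 2 z z = 0 ∧ 0 < (k3HilbertForm 2 (star z) z).re)))

/-- `qQ` = the rational Beauville–Bogomolov form of `K3^{[2]}`-type on `ℚ²³`. Local notation only. -/
local notation3 (prettyPrint := false) "qQ" => Matrix.toBilin' (Matrix.map (k3HilbertGram 2) (Int.cast : ℤ → ℚ))

/-! ### `q(v, (y, 0)) = (v|_{Λ_{K3}} . y)` -/

/-- The `K3^{[2]}` form against a vector with no `δ`-component is the K3 form of the `Λ_{K3}`-parts.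
[cite: Beauville1983, §9 Lemme 1] -/
theorem k3HilbertForm_sumElim_zero_right (v : K3HilbertIndex → ℂ) (y : K3Index → ℂ) :
    k3HilbertForm 2 v (Sum.elim y 0) = k3Form (fun k => v (Sum.inl k)) y := by
  have hv : v = Sum.elim (fun k => v (Sum.inl k)) (fun u => v (Sum.inr u)) := by
    funext i; rcases i with k | u <;> rfl
  conv_lhs => rw [hv]
  simp [k3HilbertForm, k3Form, Fintype.sum_sum_type, k3HilbertGram_inl_inl, k3HilbertGram_inr_inl]

/-! ### `ρ(S^{[2]}) ≤ ρ(S) + 1` -/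

variable {S : SchemeOver ℂ} {η : complexBetti S (2 * 1) ≃ₗ[ℂ] (K3Index → ℂ)} {p : complexBetti S (2 * 2)}
  {x : K3Index → ℂ} {H : SchemeOver ℂ} {φH : complexBetti H 2 ≃ₗ[ℂ] (K3HilbertIndex → ℂ)}
  {PH : complexBetti H (2 * 4)}

/-- **`ρ(H) ≤ ρ(S) + 1` for a smooth projective fourfold `H` marked with the period `(x, 0)` of a marked
projective K3 surface `(S, η, p, x)`** (for `H = S^{[2]}`: `NS(S^{[2]}) = i(NS(S)) ⊕ ℤδ`, Beauville): the
`ℂ`-linear map `w ↦ η⁻¹((φ_H w)|_{Λ_{K3}})` sends rational algebraic classes of `H` — of type `(1,1)`, i.e.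
`q`-orthogonal to `(x,0)` and `(x̄,0)` — to rational classes of `S` orthogonal to `x, x̄`, i.e. of type
`(1,1)`, hence algebraic (Lefschetz `(1,1)`); so it maps `N¹(H)` into `N¹(S)`, with kernel inside the line
`φ_H⁻¹(0 ⊕ ℂ)`. [cite: Beauville1983, §6 Prop. 6 and Remarque] [cite: VoisinHodgeI2002, Thm. 11.30] -/
theorem finrank_algebraicClasses_le_succ_of_hilbertSquareMarking (hS : IsK3Surface S) (hp0 : p ≠ 0)
    (hηint : ∀ c : complexBetti S (2 * 1), IsIntegralClass c ↔ ∃ v : K3Index → ℤ, η c = fun i => (v i : ℂ))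
    (hcupS : ∀ a b : complexBetti S (2 * 1),
      cupProduct (rfl : 2 * 1 + 2 * 1 = 2 * 2) a b = k3Form (η a) (η b) • p)
    (h20 : IsOfHodgeType 2 S (2 * 1) 2 0 (η.symm x)) (hxpos : 0 < (k3Form (star x) x).re)
    (hH : IsSmoothProjective 4 H) (hMH : MarkedK3Sq[H, φH, PH, Sum.elim x 0]) :
    Module.finrank ℂ (algebraicClasses H 1) ≤ Module.finrank ℂ (algebraicClasses S 1) + 1 := by
  classical
  obtain ⟨-, hintH, -, -, h11H, -⟩ := id hMH
  have hS2 : IsSmoothProjective 2 S := IsK3Surface.isSmoothProjective hS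
  haveI : FiniteDimensional ℂ (complexBetti H 2) := LinearEquiv.finiteDimensional φH.symm
  haveI : FiniteDimensional ℂ (complexBetti S (2 * 1)) := LinearEquiv.finiteDimensional η.symm
  -- `Pr w = η⁻¹ ((φ_H w)|_{Λ_{K3}})`
  set Pr : complexBetti H 2 →ₗ[ℂ] complexBetti S (2 * 1) :=
    (η.symm : (K3Index → ℂ) →ₗ[ℂ] complexBetti S (2 * 1)) ∘ₗ
      LinearMap.funLeft ℂ ℂ (Sum.inl : K3Index → K3HilbertIndex) ∘ₗ
      (φH : complexBetti H 2 →ₗ[ℂ] (K3HilbertIndex → ℂ)) with hPrdef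
  have hPr : ∀ w, Pr w = η.symm (fun k => φH w (Sum.inl k)) := fun w => rfl
  have hstar : star (Sum.elim x 0 : K3HilbertIndex → ℂ) = Sum.elim (star x) 0 := by
    funext i; rcases i with i | i <;> simp
  -- `Pr` carries `N¹(H)` into `N¹(S)`
  have hPrN : ∀ w ∈ algebraicClasses H 1, Pr w ∈ algebraicClasses S 1 := by
    have hspan := supportedClasses_eq_span_isRationalClass hH 2 1
    change algebraicClasses H 1 = Submodule.span ℂ
      {c : complexBetti H 2 | IsRationalClass c ∧ c ∈ algebraicClasses H 1} at hspan
    intro w hw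
    rw [hspan] at hw
    rw [← Submodule.mem_comap]
    refine (Submodule.span_le.2 ?_) hw
    rintro c ⟨hcrat, hcalg⟩
    rw [SetLike.mem_coe, Submodule.mem_comap]
    obtain ⟨n, hn⟩ := (isRationalClass_iff_of_markedSq hH hintH c).1 hcrat
    obtain ⟨hc1, hc2⟩ := (h11H c).1 (isOfHodgeType_of_mem_algebraicClasses_of_isSmoothProjective hH 1 hcalg)
    refine lefschetzOneOne_rational_holds hS2 (Pr c) ?_ ?_
    · exact (isRationalClass_iff_of_marking hS η hηint _).2
        ⟨fun k => n (Sum.inl k), by rw [hPr, LinearEquiv.apply_symm_apply, hn]⟩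
    · refine (oneOne_iff_of_marking hS hp0 hηint hcupS h20 hxpos (Pr c)).2 ⟨?_, ?_⟩
      · rw [hPr, LinearEquiv.apply_symm_apply, ← k3HilbertForm_sumElim_zero_right]
        exact hc1
      · rw [hPr, LinearEquiv.apply_symm_apply, ← k3HilbertForm_sumElim_zero_right, ← hstar]
        exact hc2
  -- rank–nullity for `Pr|_{N¹(H)}`
  set f : algebraicClasses H 1 →ₗ[ℂ] complexBetti S (2 * 1) := Pr ∘ₗ (algebraicClasses H 1).subtype
    with hfdef
  have hrange : Module.finrank ℂ (LinearMap.range f) ≤ Module.finrank ℂ (algebraicClasses S 1) := by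
    refine Submodule.finrank_mono ?_
    rintro _ ⟨w, rfl⟩
    exact hPrN w w.2
  -- the kernel embeds in `ℂ` by the `δ`-coordinate
  set κ : LinearMap.ker f →ₗ[ℂ] ℂ :=
    (LinearMap.proj (Sum.inr ()) : (K3HilbertIndex → ℂ) →ₗ[ℂ] ℂ) ∘ₗ
      (φH : complexBetti H 2 →ₗ[ℂ] (K3HilbertIndex → ℂ)) ∘ₗ (algebraicClasses H 1).subtype ∘ₗ
      (LinearMap.ker f).subtype with hκdef
  have hκ : ∀ w : LinearMap.ker f, κ w = φH ((w : algebraicClasses H 1) : complexBetti H 2) (Sum.inr ()) :=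
    fun w => rfl
  have hκinj : Function.Injective κ := by
    intro a b hab
    have hka : Pr ((a : algebraicClasses H 1) : complexBetti H 2) = 0 := a.2
    have hkb : Pr ((b : algebraicClasses H 1) : complexBetti H 2) = 0 := b.2
    rw [hPr, LinearEquiv.map_eq_zero_iff] at hka hkb
    apply Subtype.ext
    apply Subtype.ext
    apply φH.injective
    funext i
    rcases i with k | u
    · have ha := congrFun hka k
      have hb := congrFun hkb k
      simp only [Pi.zero_apply] at ha hb
      rw [ha, hb]
    · obtain rfl : u = () := rfl
      rw [hκ, hκ] at hab
      exact hab
  have hker : Module.finrank ℂ (LinearMap.ker f) ≤ 1 := by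
    have h := LinearMap.finrank_le_finrank_of_injective hκinj
    rwa [Module.finrank_self] at h
  have hrn := LinearMap.finrank_range_add_finrank_ker f
  omega

/-! ### `ρ(X) ≤ ρ(H)` along a partner -/

/-- **`ρ(X) ≤ ρ(H)`**: for marked `X`, marked K3 `(S, η, p, x)`, `H` marked with period `(x,0)` and the
algebraic incidence `θ` (`φ_H([θ]_* a) = (η a, 0)`), and a partner map `g` with (g1) rationality, (g4) image
`q`-orthogonal to `N¹(X)` and (g5) isometry on cup-transcendental classes, the rational matrix of
`φ ∘ g ∘ η⁻¹ ∘ pr` is an injective `q`-isometry `T_ℚ(H) ↪ T_ℚ(X)` (`T_ℚ(H)` regular), so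
`23 − ρ(H) = dim T_ℚ(H) ≤ dim T_ℚ(X) = 23 − ρ(X)`. [cite: Huybrechts2016K3, Ch. 3 Def. 2.5 and Lemma 3.1]
[cite: Beauville1983, §6 Prop. 6] -/
theorem finrank_algebraicClasses_le_of_partner
    (hcup : Voisin2003_cupProduct_algebraicClasses) {μ : OrientationFamily} (hμ : μ.HasPoincareDuality)
    {X : SchemeOver ℂ} (hX : IsSmoothProjective 4 X)
    {φ : complexBetti X 2 ≃ₗ[ℂ] (K3HilbertIndex → ℂ)} {P : complexBetti X (2 * 4)} {z : K3HilbertIndex → ℂ}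
    (hM : MarkedK3Sq[X, φ, P, z]) (hS : IsK3Surface S)
    (hηint : ∀ c : complexBetti S (2 * 1), IsIntegralClass c ↔ ∃ v : K3Index → ℤ, η c = fun i => (v i : ℂ))
    (hcupS : ∀ a b : complexBetti S (2 * 1),
      cupProduct (rfl : 2 * 1 + 2 * 1 = 2 * 2) a b = k3Form (η a) (η b) • p)
    (hH : IsSmoothProjective 4 H) (hMH : MarkedK3Sq[H, φH, PH, Sum.elim x 0])
    {θ : complexBetti (H ⊗ S) (2 * 2)} (hθ : θ ∈ algebraicClasses (H ⊗ S) 2)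
    (hi : ∀ a : complexBetti S (2 * 1),
      φH (corrAction μ hH (IsK3Surface.isSmoothProjective hS) (rfl : 2 * 1 + 2 * 2 = 2 + 2 * 2) θ a) =
        Sum.elim (η a) 0)
    {g : complexBetti S (2 * 1) →ₗ[ℂ] complexBetti X 2}
    (hg1 : ∀ a, IsRationalClass a → IsRationalClass (g a))
    (hg4 : ∀ a, ∀ d : complexBetti X 2, d ∈ algebraicClasses X 1 → k3HilbertForm 2 (φ (g a)) (φ d) = 0)
    (hg5 : ∀ a b, (∀ d ∈ algebraicClasses S 1, cupProduct (rfl : 2 * 1 + 2 * 1 = 2 * 2) a d = 0) →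
      (∀ d ∈ algebraicClasses S 1, cupProduct (rfl : 2 * 1 + 2 * 1 = 2 * 2) b d = 0) →
      k3HilbertForm 2 (φ (g a)) (φ (g b)) = k3Form (η a) (η b)) :
    Module.finrank ℂ (algebraicClasses X 1) ≤ Module.finrank ℂ (algebraicClasses H 1) := by
  classical
  obtain ⟨-, hint, -⟩ := id hM
  obtain ⟨-, hintH, -⟩ := id hMH
  have hS2 : IsSmoothProjective 2 S := IsK3Surface.isSmoothProjective hS
  obtain ⟨NX, hNX⟩ := exists_ratNeronSeveri (X := X) φ
  obtain ⟨NH, hNH⟩ := exists_ratNeronSeveri (X := H) φH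
  have hTnd := restrict_ratTransc_nondegenerate hH hMH hNH
  -- `[θ]_*` carries `N¹(S)` into `N¹(H)`; vectors of `T_H`
  have hiN : ∀ d ∈ algebraicClasses S 1,
      corrAction μ hH hS2 (rfl : 2 * 1 + 2 * 2 = 2 + 2 * 2) θ d ∈ algebraicClasses H 1 := fun d hd =>
    corrAction_mem_algebraicClasses_of_cupProductFact hcup hμ hH hS2 (q := 1) rfl (by norm_num) hθ hd
  have hTsum : ∀ t ∈ (qQ).orthogonal NH,
      (fun i => (t i : ℂ)) = Sum.elim (fun k => (t (Sum.inl k) : ℂ)) 0 := fun t ht =>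
    ratCast_eq_sumElim_of_mem_ratTransc hH hMH hNH ht
  have hTtransc : ∀ t ∈ (qQ).orthogonal NH, ∀ d ∈ algebraicClasses S 1,
      cupProduct (rfl : 2 * 1 + 2 * 1 = 2 * 2) (η.symm (fun k => (t (Sum.inl k) : ℂ))) d = 0 := by
    intro t ht d hd
    have h0 : k3HilbertForm 2 (fun i => (t i : ℂ))
        (φH (corrAction μ hH hS2 (rfl : 2 * 1 + 2 * 2 = 2 + 2 * 2) θ d)) = 0 :=
      (ratCast_bbfTransc_iff_mem_orthogonal hH hintH hNH t).2 ht _ (hiN d hd)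
    rw [hi d, hTsum t ht, k3HilbertForm_inl] at h0
    rw [hcupS, LinearEquiv.apply_symm_apply, h0, zero_smul]
  -- the rational matrix of `φ ∘ g ∘ η⁻¹`, and `G' = Gq ∘ pr`
  set L : (K3Index → ℂ) →ₗ[ℂ] (K3HilbertIndex → ℂ) :=
    (φ : complexBetti X 2 →ₗ[ℂ] (K3HilbertIndex → ℂ)) ∘ₗ g ∘ₗ
      (η.symm : (K3Index → ℂ) →ₗ[ℂ] complexBetti S (2 * 1)) with hLdef
  have hLapp : ∀ y, L y = φ (g (η.symm y)) := fun y => rfl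
  have hLrat : ∀ v : K3Index → ℚ, ∃ w : K3HilbertIndex → ℚ,
      L (fun i => (v i : ℂ)) = fun i => (w i : ℂ) := fun v => by
    rw [hLapp]
    exact (isRationalClass_iff_of_markedSq hX hint _).1
      (hg1 _ ((isRationalClass_iff_of_marking hS η hηint _).2 ⟨v, LinearEquiv.apply_symm_apply _ _⟩))
  obtain ⟨Gq, hGq⟩ := exists_ratLinear_of_forall_ratCast L hLrat
  set G' : (K3HilbertIndex → ℚ) →ₗ[ℚ] (K3HilbertIndex → ℚ) :=
    Gq ∘ₗ LinearMap.funLeft ℚ ℚ (Sum.inl : K3Index → K3HilbertIndex) with hG'def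
  have hG'rat : ∀ t ∈ (qQ).orthogonal NH,
      (fun i => ((G' t) i : ℂ)) = φ (g (η.symm (fun k => (t (Sum.inl k) : ℂ)))) := fun t _ => by
    rw [hG'def, LinearMap.comp_apply, hGq, hLapp]
    rfl
  have hG'iso : ∀ a ∈ (qQ).orthogonal NH, ∀ b ∈ (qQ).orthogonal NH, qQ (G' a) (G' b) = qQ a b := by
    intro a ha b hb
    have h : k3HilbertForm 2 (fun i => ((G' a) i : ℂ)) (fun i => ((G' b) i : ℂ)) =
        k3HilbertForm 2 (fun i => (a i : ℂ)) (fun i => (b i : ℂ)) := by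
      rw [hG'rat a ha, hG'rat b hb, hg5 _ _ (hTtransc a ha) (hTtransc b hb),
        LinearEquiv.apply_symm_apply, LinearEquiv.apply_symm_apply, hTsum a ha, hTsum b hb,
        k3HilbertForm_inl]
    rw [k3HilbertForm_ratCast, k3HilbertForm_ratCast] at h
    exact_mod_cast h
  -- `G'(T_H) ⊆ T_X` by (g4)
  have hG'T : ∀ t ∈ (qQ).orthogonal NH, G' t ∈ (qQ).orthogonal NX := by
    intro t ht
    refine (ratCast_bbfTransc_iff_mem_orthogonal hX hint hNX (G' t)).1 fun d hd => ?_
    rw [hG'rat t ht]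
    exact hg4 _ d hd
  -- the restricted map `T_H → T_X` is injective
  set GT : (qQ).orthogonal NH →ₗ[ℚ] (qQ).orthogonal NX :=
    LinearMap.codRestrict ((qQ).orthogonal NX) (G' ∘ₗ ((qQ).orthogonal NH).subtype)
      (fun t => hG'T t t.2) with hGTdef
  have hGTapp : ∀ t : (qQ).orthogonal NH, (GT t : K3HilbertIndex → ℚ) = G' t := fun t => rfl
  have hGTinj : Function.Injective GT := by
    intro a b hab
    have hab' : G' (a : K3HilbertIndex → ℚ) = G' b := by
      rw [← hGTapp, ← hGTapp, hab]
    have h0 : G' ((a - b : (qQ).orthogonal NH) : K3HilbertIndex → ℚ) = 0 := by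
      rw [Submodule.coe_sub, map_sub, hab', sub_self]
    have hzero : (a - b : (qQ).orthogonal NH) = 0 := by
      apply hTnd.1
      intro n
      rw [LinearMap.BilinForm.restrict_apply]
      show qQ ((a - b : (qQ).orthogonal NH) : K3HilbertIndex → ℚ) n = 0
      rw [← hG'iso _ (a - b).2 _ n.2, h0, map_zero, LinearMap.zero_apply]
    exact sub_eq_zero.1 hzero
  have hle := LinearMap.finrank_le_finrank_of_injective hGTinj
  rw [finrank_ratTransc hH hintH hNH, finrank_ratTransc hX hint hNX] at hle
  have hX23 : Module.finrank ℂ (algebraicClasses X 1) ≤ 23 := by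
    rw [← finrank_ratNeronSeveri hX hint hNX, ← finrank_rat23]
    exact Submodule.finrank_le NX
  have hH23 : Module.finrank ℂ (algebraicClasses H 1) ≤ 23 := by
    rw [← finrank_ratNeronSeveri hH hintH hNH, ← finrank_rat23]
    exact Submodule.finrank_le NH
  omega

/-- **`ρ(X) ≤ ρ(S) + 1` along a K3 partner realised on a marked Hilbert square** (the two previous
bounds): every marked `K3^{[2]}`-type fourfold `X` with a partner `(S, g)` as above — in particular the
partner returned by `PartnerExistence` — has `ρ(S) ≥ ρ(X) − 1`, so K3-square theorems indexed by `ρ(S)`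
transfer to `K3^{[2]}`-type fourfolds indexed by `ρ(X)`. [cite: Beauville1983, §6 Prop. 6 and Remarque]
[cite: Huybrechts2016K3, Ch. 3 Lemma 3.1] -/
theorem finrank_algebraicClasses_le_partner_succ
    (hcup : Voisin2003_cupProduct_algebraicClasses) {μ : OrientationFamily} (hμ : μ.HasPoincareDuality)
    {X : SchemeOver ℂ} (hX : IsSmoothProjective 4 X)
    {φ : complexBetti X 2 ≃ₗ[ℂ] (K3HilbertIndex → ℂ)} {P : complexBetti X (2 * 4)} {z : K3HilbertIndex → ℂ}
    (hM : MarkedK3Sq[X, φ, P, z]) (hS : IsK3Surface S) (hp0 : p ≠ 0)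
    (hηint : ∀ c : complexBetti S (2 * 1), IsIntegralClass c ↔ ∃ v : K3Index → ℤ, η c = fun i => (v i : ℂ))
    (hcupS : ∀ a b : complexBetti S (2 * 1),
      cupProduct (rfl : 2 * 1 + 2 * 1 = 2 * 2) a b = k3Form (η a) (η b) • p)
    (h20 : IsOfHodgeType 2 S (2 * 1) 2 0 (η.symm x)) (hxpos : 0 < (k3Form (star x) x).re)
    (hH : IsSmoothProjective 4 H) (hMH : MarkedK3Sq[H, φH, PH, Sum.elim x 0])
    {θ : complexBetti (H ⊗ S) (2 * 2)} (hθ : θ ∈ algebraicClasses (H ⊗ S) 2)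
    (hi : ∀ a : complexBetti S (2 * 1),
      φH (corrAction μ hH (IsK3Surface.isSmoothProjective hS) (rfl : 2 * 1 + 2 * 2 = 2 + 2 * 2) θ a) =
        Sum.elim (η a) 0)
    {g : complexBetti S (2 * 1) →ₗ[ℂ] complexBetti X 2}
    (hg1 : ∀ a, IsRationalClass a → IsRationalClass (g a))
    (hg4 : ∀ a, ∀ d : complexBetti X 2, d ∈ algebraicClasses X 1 → k3HilbertForm 2 (φ (g a)) (φ d) = 0)
    (hg5 : ∀ a b, (∀ d ∈ algebraicClasses S 1, cupProduct (rfl : 2 * 1 + 2 * 1 = 2 * 2) a d = 0) →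
      (∀ d ∈ algebraicClasses S 1, cupProduct (rfl : 2 * 1 + 2 * 1 = 2 * 2) b d = 0) →
      k3HilbertForm 2 (φ (g a)) (φ (g b)) = k3Form (η a) (η b)) :
    Module.finrank ℂ (algebraicClasses X 1) ≤ Module.finrank ℂ (algebraicClasses S 1) + 1 :=
  (finrank_algebraicClasses_le_of_partner hcup hμ hX hM hS hηint hcupS hH hMH hθ hi hg1 hg4 hg5).trans
    (finrank_algebraicClasses_le_succ_of_hilbertSquareMarking hS hp0 hηint hcupS h20 hxpos hH hMH)

end Summit.HodgeConjecture.HodgeConjecture.Theorems.MarkmanPartnerTransport.PartnerLattice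

end
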